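import Summits.Ventures.CertifiedQuantumChemistry.Rows.FrozenCoreRelaxationFeasible
import Literature.MathematicalPhysics.QuantumChemistry.FrozenCoreHamiltonian
import Literature.MathematicalPhysics.QuantumChemistry.RelaxationEnergyHierarchy
import HarnessLib

/-!
# Ventures/CertifiedQuantumChemistry — Rows/FrozenCoreRelaxationEnergy.lean: the energy of the extended
# pair is the frozen-core energy; `E_PQG(full; N + 2|C|) ≤ E_PQG(frozen core; N)`

HONEST FRAMING (verbatim): certified bounds for a stated model Hamiltonian in a stated basis; not a
claim about the real molecule beyond that model.

Seat rdm-B (gen 22), file 6 of the relaxation-level frozen-core set. (1) Generic bookkeeping: a pairing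
against a congruence `X M Xᴴ` is a pairing against `M` with the transported table
(`sum_sum_mul_conj_apply`, via `Matrix.trace_mul_comm`); hence the ONE-BODY functionals of the extended
one-matrix, `Σ_{pq} W_pq γ'_pq = Σ_{ij} W_{e i,e j} γ_ij + Σ_{k∈K} W_kk` (`sum_mul_frozenOne`), and the
TWO-BODY functionals of the extended two-matrix (`sum_mul_frozenTwo`): the all-active part, the Coulomb
(`+`) / exchange (`−`) core field `Σ_{k∈K} (W_{(ei,k),(ej,k)} − W_{(ei,k),(k,ej)} − W_{(k,ei),(ej,k)} +
W_{(k,ei),(k,ej)})` on `γ_ij`, and the core pair constant `Σ_{k,k'∈K} (W_{(k,k'),(k,k')} − W_{(k',k),(k,k')})`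
(`sum_mul_twoRDM_single`). (2) The molecular frozen core `e = orbEmb φ`, `K = orbs C` (`φ : Λ ↪o Λ'`
the active orbitals, `C` the core, `φ x ∉ C`): the spin-free functional `rdmEnergy` of
`VariationalRDMRelaxation.lean` as spin-orbital pairings (`sum_spinTable_one`, `sum_spinTable_two`,
HJO (2.2.3), (2.2.10)) and **`rdmEnergy_frozen`**: `E_{h,g,h_nuc}(γ', Γ') = E_{h^FC, g|_act, h_nuc + E_core}(γ, Γ)`
with EXACTLY the general-table frozen-core data of
`Literature/…/FrozenCoreHamiltonian.lean`'s `conjTranspose_frozenEmbed_mul_molecularHamiltonian_mul_frozenEmbed`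
(`h^FC_xy = h_{φx,φy} + Σ_c (g_{φxφycc} + g_{ccφxφy}) − ½ Σ_c (g_{φxccφy} + g_{cφyφxc})`,
`E_core = 2 Σ_c h_cc + Σ_{cd} (2 g_ccdd − g_cddc)`) — the pair-level form of `Vᴴ Ĥ V = Ĥ^FC`. (3) THE
RESULT **`pqgEnergy_le_frozenCore`**: for `N + 2 ≤ 2|Λ|`,
`E_PQG(h, g, h_nuc; N + 2|C|) ≤ E_PQG(h^FC, g|_act, h_nuc + E_core; N)` — every DQG-feasible active pair
extends (`isDQGFeasible_frozen`, file 5) to a DQG-feasible pair of the big space with the same energy.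
The relaxation-level twin of `groundEnergy_le_frozenCore`: freezing a core is an INNER approximation of
the variational 2-RDM programme as well, so the DQG value of the full model lies below the frozen-core
DQG value, and — as on the exact side (`Rows/FrozenCoreLowerRowsCounterexample.lean`) — nothing is
claimed conversely. All PROVED (0 sorry, no definition); no row, no certificate, nothing about a deposited
model. References: T. Helgaker, P. Jørgensen, J. Olsen (2000) §2.2.1, §12.5.1 (12.5.12), (12.5.16)
[HelgakerJorgensenOlsen2000]; E. Koridon et al., Phys. Rev. Research 3 (2021) 033127, App. A
[KoridonEtAl2021]; D. A. Mazziotti (2007) §II.A–B [Mazziotti2007RDMChapter]; M. Nakata et al., J. Chem.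
Phys. 128 (2008) 164113 §II.C [NakataEtAl2008].
-/

noncomputable section

namespace Summit.Ventures.CertifiedQuantumChemistry

open Matrix Finset
open Literature.MathematicalPhysics.QuantumLattice Literature.MathematicalPhysics.QuantumChemistry JWEmbed
open scoped ComplexOrder

variable {ι ι' : Type*} [LinearOrder ι] [LinearOrder ι'] [Fintype ι] [Fintype ι']
variable (e : ι ↪o ι') {K : Finset ι'}

/-! ## Linear functionals of the extended pair (energy bookkeeping for general tables) -/

section Energy

variable (γ : Matrix ι ι ℂ) (Γ : Matrix (ι × ι) (ι × ι) ℂ)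

/-- A bilinear pairing against a congruence `X M Xᴴ` is a pairing against `M` with the table
transported by `X`: `Σ_{PQ} W_PQ (X M Xᴴ)_PQ = Σ_{xy} M_xy Σ_{PQ} W_PQ X_Px (star X_Qy)`. -/
theorem sum_sum_mul_conj_apply {m n : Type*} [Fintype m] [Fintype n] (W : m → m → ℂ) (X : Matrix m n ℂ)
    (M : Matrix n n ℂ) :
    ∑ P, ∑ Q, W P Q * (X * M * Xᴴ) P Q = ∑ x, ∑ y, M x y * ∑ P, ∑ Q, W P Q * X P x * star (X Q y) := by
  have h1 : ∑ P, ∑ Q, W P Q * (X * M * Xᴴ) P Q = Matrix.trace (Matrix.of W * (X * M * Xᴴ)ᵀ) := by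
    simp only [Matrix.trace, Matrix.diag_apply, Matrix.mul_apply, Matrix.transpose_apply, Matrix.of_apply]
  have h2 : Matrix.of W * (X * M * Xᴴ)ᵀ = (Matrix.of W * Xᴴᵀ * Mᵀ) * Xᵀ := by
    rw [Matrix.transpose_mul, Matrix.transpose_mul]
    simp only [Matrix.mul_assoc]
  rw [h1, h2, Matrix.trace_mul_comm]
  simp only [Matrix.trace, Matrix.diag_apply, Matrix.mul_apply, Matrix.transpose_apply,
    Matrix.conjTranspose_apply, Matrix.of_apply, Finset.mul_sum, Finset.sum_mul]
  refine Finset.sum_congr rfl fun x _ => ?_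
  rw [Finset.sum_comm]
  refine Finset.sum_congr rfl fun y _ => Finset.sum_congr rfl fun P _ => Finset.sum_congr rfl fun Q _ => ?_
  ring

omit [Fintype ι] in
/-- Collapsing a pair sum over the big space against `[P = (a, b)]`. -/
theorem sum_pair_ite_eq (a b : ι') (f : ι' × ι' → ℂ) :
    ∑ P : ι' × ι', (if P.1 = a ∧ P.2 = b then f P else 0) = f (a, b) := by
  have h : ∀ P : ι' × ι', (P.1 = a ∧ P.2 = b) ↔ P = (a, b) := fun P => by rw [Prod.eq_iff_fst_eq_snd_eq]
  simp only [h, Finset.sum_ite_eq', Finset.mem_univ, if_true]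

omit [Fintype ι] in
/-- The table transported by `embOne`: `Σ_{pq} W_pq E_px (star E_qy) = W_{e x, e y}`. -/
theorem sum_sum_embOne (W : ι' → ι' → ℂ) (x y : ι) :
    ∑ p, ∑ q, W p q * embOne e p x * star (embOne e q y) = W (e x) (e y) := by
  simp only [embOne_apply, apply_ite star, star_one, star_zero, mul_ite, mul_one, mul_zero,
    Finset.sum_ite_eq', Finset.mem_univ, if_true]

omit [Fintype ι] in
/-- The table transported by `embTwo`: `Σ_{PQ} W_PQ E₂_Px (star E₂_Qy) = W_{ê x, ê y}`. -/
theorem sum_sum_embTwo (W : ι' × ι' → ι' × ι' → ℂ) (x y : ι × ι) :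
    ∑ P, ∑ Q, W P Q * embTwo e P x * star (embTwo e Q y) = W (e x.1, e x.2) (e y.1, e y.2) := by
  simp only [embTwo_apply, apply_ite star, star_one, star_zero, mul_ite, mul_one, mul_zero, sum_pair_ite_eq]

omit [Fintype ι] in
/-- The table transported by `mixedPair e k`: the four Coulomb / exchange placements. -/
theorem sum_sum_mixedPair (W : ι' × ι' → ι' × ι' → ℂ) (k : ι') (i j : ι) :
    ∑ P, ∑ Q, W P Q * mixedPair e k P i * star (mixedPair e k Q j) =
      W (e i, k) (e j, k) - W (e i, k) (k, e j) - W (k, e i) (e j, k) + W (k, e i) (k, e j) := by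
  simp only [mixedPair_apply, star_sub, apply_ite star, star_one, star_zero, mul_sub, mul_ite,
    mul_one, mul_zero, Finset.sum_sub_distrib, sum_pair_ite_eq]
  ring

/-- **One-body functionals of the extended one-matrix**:
`Σ_{pq} W_pq γ'_pq = Σ_{ij} W_{e i, e j} γ_ij + Σ_{k∈K} W_kk`. -/
theorem sum_mul_frozenOne (W : ι' → ι' → ℂ) :
    ∑ p, ∑ q, W p q * frozenOne e K γ p q = ∑ i, ∑ j, W (e i) (e j) * γ i j + ∑ k ∈ K, W k k := by
  simp only [frozenOne, Matrix.add_apply, mul_add, Finset.sum_add_distrib]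
  congr 1
  · rw [sum_sum_mul_conj_apply]
    refine Finset.sum_congr rfl fun x _ => Finset.sum_congr rfl fun y _ => ?_
    rw [sum_sum_embOne, mul_comm]
  · simp only [oneRDM_single, mul_ite, mul_one, mul_zero, ite_and]
    rw [Finset.sum_comm]
    simp only [Finset.sum_ite_eq', Finset.mem_univ, if_true]
    rw [← Finset.sum_filter, Finset.filter_mem_eq_inter, Finset.univ_inter]

/-- The two-matrix of `|K⟩` paired with a pair table: the core pair constant
`Σ_{k,k'∈K} (W_{(k,k'),(k,k')} − W_{(k',k),(k,k')})`. -/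
theorem sum_mul_twoRDM_single (W : ι' × ι' → ι' × ι' → ℂ) :
    ∑ P : ι' × ι', ∑ Q : ι' × ι', W P Q * twoRDM (Pi.single K (1 : ℂ)) P Q =
      ∑ k ∈ K, ∑ k' ∈ K, (W (k, k') (k, k') - W (k', k) (k, k')) := by
  rw [Finset.sum_comm, Fintype.sum_prod_type]
  rw [← Finset.sum_filter_add_sum_filter_not Finset.univ (· ∈ K)]
  rw [Finset.filter_mem_eq_inter, Finset.univ_inter, Finset.sum_eq_zero (s := Finset.univ.filter (· ∉ K)), add_zero]
  · refine Finset.sum_congr rfl fun q hq => ?_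
    rw [← Finset.sum_filter_add_sum_filter_not Finset.univ (· ∈ K)]
    rw [Finset.filter_mem_eq_inter, Finset.univ_inter, Finset.sum_eq_zero (s := Finset.univ.filter (· ∉ K)), add_zero]
    · refine Finset.sum_congr rfl fun s hs => ?_
      simp only [Fintype.sum_prod_type, twoRDM_single, hq, hs, and_self, if_true, mul_sub, mul_ite, mul_one,
        mul_zero, Finset.sum_sub_distrib, ite_and, Finset.sum_ite_irrel, Finset.sum_const_zero,
        Finset.sum_ite_eq', Finset.mem_univ, if_true]
    · intro s hs
      rw [Finset.mem_filter] at hs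
      simp only [Fintype.sum_prod_type, twoRDM_single, hs.2, false_and, if_false, mul_zero, Finset.sum_const_zero]
  · intro q hq
    rw [Finset.mem_filter] at hq
    refine Finset.sum_eq_zero fun s _ => ?_
    simp only [Fintype.sum_prod_type, twoRDM_single, hq.2, and_false, if_false, mul_zero, Finset.sum_const_zero]

/-- **Two-body functionals of the extended two-matrix** (a pair table `W_{PQ}` paired with `Γ'_{PQ}`):
the all-active part, the Coulomb (`+`) / exchange (`−`) core field on the one-matrix, and the core
pair constant. -/
theorem sum_mul_frozenTwo (W : ι' × ι' → ι' × ι' → ℂ) :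
    ∑ P : ι' × ι', ∑ Q : ι' × ι', W P Q * frozenTwo e K γ Γ P Q =
      ∑ x : ι × ι, ∑ y : ι × ι, W (e x.1, e x.2) (e y.1, e y.2) * Γ x y +
        ∑ i, ∑ j, (∑ k ∈ K, (W (e i, k) (e j, k) - W (e i, k) (k, e j) - W (k, e i) (e j, k) + W (k, e i) (k, e j))) *
          γ i j +
        ∑ k ∈ K, ∑ k' ∈ K, (W (k, k') (k, k') - W (k', k) (k, k')) := by
  simp only [frozenTwo, Matrix.add_apply, mul_add, Finset.sum_add_distrib]
  congr 1
  congr 1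
  · rw [sum_sum_mul_conj_apply]
    refine Finset.sum_congr rfl fun x _ => Finset.sum_congr rfl fun y _ => ?_
    rw [sum_sum_embTwo, mul_comm]
  · have hk : ∀ k : ι', ∑ P : ι' × ι', ∑ Q : ι' × ι', W P Q * (mixedPair e k * γ * (mixedPair e k)ᴴ) P Q =
        ∑ i, ∑ j, (W (e i, k) (e j, k) - W (e i, k) (k, e j) - W (k, e i) (e j, k) + W (k, e i) (k, e j)) * γ i j := by
      intro k
      rw [sum_sum_mul_conj_apply]
      refine Finset.sum_congr rfl fun i _ => Finset.sum_congr rfl fun j _ => ?_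
      rw [sum_sum_mixedPair, mul_comm]
    calc ∑ P : ι' × ι', ∑ Q : ι' × ι', W P Q * (∑ k ∈ K, mixedPair e k * γ * (mixedPair e k)ᴴ) P Q
        = ∑ k ∈ K, ∑ P : ι' × ι', ∑ Q : ι' × ι', W P Q * (mixedPair e k * γ * (mixedPair e k)ᴴ) P Q := by
          simp only [Matrix.sum_apply, Finset.mul_sum]
          exact (Finset.sum_congr rfl fun P _ => Finset.sum_comm).trans Finset.sum_comm
      _ = ∑ k ∈ K, ∑ i, ∑ j,
            (W (e i, k) (e j, k) - W (e i, k) (k, e j) - W (k, e i) (e j, k) + W (k, e i) (k, e j)) * γ i j :=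
          Finset.sum_congr rfl fun k _ => hk k
      _ = _ := by
          rw [Finset.sum_comm]
          refine Finset.sum_congr rfl fun i _ => ?_
          rw [Finset.sum_comm]
          refine Finset.sum_congr rfl fun j _ => ?_
          simp only [Finset.sum_mul, Finset.sum_add_distrib, Finset.sum_sub_distrib, add_mul, sub_mul]
  · exact sum_mul_twoRDM_single (K := K) W

end Energy

/-! ## The molecular frozen core: the energy functional of the extended pair -/

section Molecular

variable {Λ Λ' : Type*} [LinearOrder Λ] [Fintype Λ] [LinearOrder Λ'] [Fintype Λ']

omit [LinearOrder Λ] in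
/-- The one-body part of `rdmEnergy` as a pairing over spin orbitals with the spin-diagonal table
`W_{(pσ),(qσ')} = [σ = σ'] h_pq` (HJO (2.2.3)). -/
theorem sum_spinTable_one (hh : Λ → Λ → ℂ) (M : Matrix (Orb Λ) (Orb Λ) ℂ) :
    ∑ P : Orb Λ, ∑ Q : Orb Λ,
        (if (ofLex P).2 = (ofLex Q).2 then hh (ofLex P).1 (ofLex Q).1 else 0) * M P Q =
      ∑ p, ∑ q, hh p q * ∑ σ : Fin 2, M (orb p σ) (orb q σ) := by
  simp only [sum_orb_eq_sum_sum, ofLex_orb, ite_mul, zero_mul, Finset.sum_ite_eq, Finset.mem_univ, if_true,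
    Finset.mul_sum]
  simp only [Finset.sum_comm (s := (Finset.univ : Finset (Fin 2))) (t := (Finset.univ : Finset Λ))]

omit [LinearOrder Λ] in
/-- The two-body part of `rdmEnergy` as a pairing over spin-orbital pairs with the table
`W_{(pσ)(qσ')(rτ)(sτ')} = [σ = σ'][τ = τ'] g_pqrs` (HJO (2.2.10)). -/
theorem sum_spinTable_two (gg : Λ → Λ → Λ → Λ → ℂ) (M : Matrix (Orb Λ × Orb Λ) (Orb Λ × Orb Λ) ℂ) :
    ∑ P : Orb Λ × Orb Λ, ∑ Q : Orb Λ × Orb Λ,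
        (if (ofLex P.1).2 = (ofLex Q.1).2 ∧ (ofLex P.2).2 = (ofLex Q.2).2 then
            gg (ofLex P.1).1 (ofLex Q.1).1 (ofLex P.2).1 (ofLex Q.2).1 else 0) * M P Q =
      ∑ p, ∑ q, ∑ r, ∑ s, gg p q r s * ∑ σ : Fin 2, ∑ τ : Fin 2, M (orb p σ, orb r τ) (orb q σ, orb s τ) := by
  simp only [Fintype.sum_prod_type, sum_orb_eq_sum_sum, ofLex_orb, ite_and, ite_mul, zero_mul,
    Finset.sum_ite_irrel, Finset.sum_const_zero, Finset.sum_ite_eq, Finset.mem_univ, if_true, Finset.mul_sum]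
  simp only [Finset.sum_comm (s := (Finset.univ : Finset (Fin 2))) (t := (Finset.univ : Finset Λ))]
  refine Finset.sum_congr rfl fun p _ => ?_
  rw [Finset.sum_comm]


variable (φ : Λ ↪o Λ') {C : Finset Λ'}

omit [Fintype Λ] [Fintype Λ'] in
/-- Components of an embedded spin orbital: `orbEmb φ i = (φ p_i, σ_i)`. -/
theorem ofLex_orbEmb (i : Orb Λ) : ofLex (orbEmb φ i) = (φ (ofLex i).1, (ofLex i).2) := rfl

/-- **THE ENERGY OF THE EXTENDED PAIR IS THE FROZEN-CORE ENERGY OF THE ACTIVE PAIR**: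
`E_{h,g,h_nuc}(γ', Γ') = E_{h^FC, g|_act, h_nuc + E_core}(γ, Γ)` with exactly the frozen-core tables of
`conjTranspose_frozenEmbed_mul_molecularHamiltonian_mul_frozenEmbed` (general complex tables) — the
pair-level form of `Vᴴ Ĥ V = Ĥ^FC`. -/
theorem rdmEnergy_frozen (h : Λ' → Λ' → ℂ) (g : Λ' → Λ' → Λ' → Λ' → ℂ) (hnuc : ℂ)
    (γ : Matrix (Orb Λ) (Orb Λ) ℂ) (Γ : Matrix (Orb Λ × Orb Λ) (Orb Λ × Orb Λ) ℂ) :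
    rdmEnergy h g hnuc (frozenOne (orbEmb φ) (orbs C) γ) (frozenTwo (orbEmb φ) (orbs C) γ Γ) =
      rdmEnergy
        (fun x y => h (φ x) (φ y) + ∑ c ∈ C, (g (φ x) (φ y) c c + g c c (φ x) (φ y)) -
          (1 / 2 : ℂ) * ∑ c ∈ C, (g (φ x) c c (φ y) + g c (φ y) (φ x) c))
        (fun x y z w => g (φ x) (φ y) (φ z) (φ w))
        (hnuc + (2 * ∑ c ∈ C, h c c + ∑ c ∈ C, ∑ d ∈ C, (2 * g c c d d - g c d d c))) γ Γ := by
  rw [rdmEnergy, rdmEnergy, ← sum_spinTable_one h, ← sum_spinTable_two g, sum_mul_frozenOne,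
    sum_mul_frozenTwo, ← sum_spinTable_one _ γ, ← sum_spinTable_two _ Γ]
  simp only [ofLex_orbEmb, sum_orbs_eq_sum_sum, ofLex_orb]
  -- spin bookkeeping of the core contributions (per core orbital), as in `FrozenCoreHamiltonian`
  have inner : ∀ (x y : Λ) (σ σ' : Fin 2) (c : Λ'),
      ∑ τ : Fin 2, ((((if σ = σ' ∧ True then g (φ x) (φ y) c c else 0) -
          if σ = τ ∧ τ = σ' then g (φ x) c c (φ y) else 0) -
          if τ = σ' ∧ σ = τ then g c (φ y) (φ x) c else 0) +
          if True ∧ σ = σ' then g c c (φ x) (φ y) else 0) =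
        if σ = σ' then 2 * (g (φ x) (φ y) c c + g c c (φ x) (φ y)) - (g (φ x) c c (φ y) + g c (φ y) (φ x) c)
        else 0 := by
    intro x y σ σ' c
    fin_cases σ <;> fin_cases σ' <;> simp [Fin.sum_univ_two] <;> ring
  have key1 : ∀ (x y : Λ) (σ σ' : Fin 2),
      (if σ = σ' then h (φ x) (φ y) + ∑ c ∈ C, (g (φ x) (φ y) c c + g c c (φ x) (φ y)) -
          1 / 2 * ∑ c ∈ C, (g (φ x) c c (φ y) + g c (φ y) (φ x) c) else 0) =
        (if σ = σ' then h (φ x) (φ y) else 0) +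
          (1 / 2 : ℂ) * ∑ c ∈ C, (if σ = σ' then
            2 * (g (φ x) (φ y) c c + g c c (φ x) (φ y)) - (g (φ x) c c (φ y) + g c (φ y) (φ x) c) else 0) := by
    intro x y σ σ'
    by_cases hs : σ = σ'
    · simp only [hs, if_true]
      rw [Finset.sum_sub_distrib, ← Finset.mul_sum]
      ring
    · simp [hs]
  have inner1 : ∑ c ∈ C, ∑ σ : Fin 2, (if True then h c c else (0 : ℂ)) = 2 * ∑ c ∈ C, h c c := by
    rw [Finset.mul_sum]
    refine Finset.sum_congr rfl fun c _ => ?_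
    simp [two_mul]
  have inner2 : ∑ c ∈ C, ∑ σ : Fin 2, ∑ d ∈ C, ∑ τ : Fin 2,
      ((if True ∧ True then g c c d d else (0 : ℂ)) - if τ = σ ∧ σ = τ then g d c c d else 0) =
        2 * ∑ c ∈ C, ∑ d ∈ C, (2 * g c c d d - g c d d c) := by
    have hcd : ∀ c : Λ', ∑ σ : Fin 2, ∑ d ∈ C, ∑ τ : Fin 2,
        ((if True ∧ True then g c c d d else (0 : ℂ)) - if τ = σ ∧ σ = τ then g d c c d else 0) =
          ∑ d ∈ C, (4 * g c c d d - 2 * g d c c d) := by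
      intro c
      rw [Finset.sum_comm]
      refine Finset.sum_congr rfl fun d _ => ?_
      simp [Fin.sum_univ_two]
      ring
    rw [Finset.sum_congr rfl fun c _ => hcd c]
    have hswap : ∑ c ∈ C, ∑ d ∈ C, (4 * g c c d d - 2 * g d c c d) =
        ∑ c ∈ C, ∑ d ∈ C, (4 * g c c d d - 2 * g c d d c) := by
      simp only [Finset.sum_sub_distrib]
      congr 1
      exact Finset.sum_comm
    rw [hswap, Finset.mul_sum]
    refine Finset.sum_congr rfl fun c _ => ?_
    rw [Finset.mul_sum]
    refine Finset.sum_congr rfl fun d _ => ?_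
    ring
  have H4 : ∑ P : Orb Λ, ∑ Q : Orb Λ,
      (if (ofLex P).2 = (ofLex Q).2 then
          h (φ (ofLex P).1) (φ (ofLex Q).1) +
              ∑ c ∈ C, (g (φ (ofLex P).1) (φ (ofLex Q).1) c c + g c c (φ (ofLex P).1) (φ (ofLex Q).1)) -
            1 / 2 * ∑ c ∈ C, (g (φ (ofLex P).1) c c (φ (ofLex Q).1) + g c (φ (ofLex Q).1) (φ (ofLex P).1) c)
        else 0) * γ P Q =
      ∑ P : Orb Λ, ∑ Q : Orb Λ,
        (if (ofLex P).2 = (ofLex Q).2 then h (φ (ofLex P).1) (φ (ofLex Q).1) else 0) * γ P Q +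
      (1 / 2 : ℂ) * ∑ P : Orb Λ, ∑ Q : Orb Λ, (∑ c ∈ C, (if (ofLex P).2 = (ofLex Q).2 then
            2 * (g (φ (ofLex P).1) (φ (ofLex Q).1) c c + g c c (φ (ofLex P).1) (φ (ofLex Q).1)) -
              (g (φ (ofLex P).1) c c (φ (ofLex Q).1) + g c (φ (ofLex Q).1) (φ (ofLex P).1) c) else 0)) * γ P Q := by
    rw [Finset.mul_sum, ← Finset.sum_add_distrib]
    refine Finset.sum_congr rfl fun P _ => ?_
    rw [Finset.mul_sum, ← Finset.sum_add_distrib]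
    refine Finset.sum_congr rfl fun Q _ => ?_
    rw [key1]
    ring
  simp only [inner]
  rw [inner1, inner2, H4]
  ring



/-- **THE DQG RELAXATION VALUE OF THE FULL MODEL LIES BELOW THAT OF ANY FROZEN-CORE REDUCTION**
(`N`-electron form): `E_PQG(h, g, h_nuc; N + 2|C|) ≤ E_PQG(h^FC, g|_act, h_nuc + E_core; N)` for every
active particle number `N` with at least two empty active spin orbitals (`N + 2 ≤ 2|Λ|`), the tables being
exactly those of `conjTranspose_frozenEmbed_mul_molecularHamiltonian_mul_frozenEmbed`. Proof: every
DQG-feasible active pair extends (`isDQGFeasible_frozen`) to a DQG-feasible pair of the big space with the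
same energy (`rdmEnergy_frozen`). The relaxation-level twin of `groundEnergy_le_frozenCore`: freezing a
core is an INNER approximation of the DQG programme too, so a certified DQG lower bound of the full model
is also below the frozen-core relaxation value — and, as on the exact side, NOT conversely. -/
theorem pqgEnergy_le_frozenCore (hC : ∀ x, φ x ∉ C) (h : Λ' → Λ' → ℂ) (g : Λ' → Λ' → Λ' → Λ' → ℂ)
    (hnuc : ℂ) {N : ℕ} (hN : N + 2 ≤ Fintype.card (Orb Λ)) :
    pqgEnergy h g hnuc (N + 2 * C.card) ≤
      pqgEnergy
        (fun x y => h (φ x) (φ y) + ∑ c ∈ C, (g (φ x) (φ y) c c + g c c (φ x) (φ y)) -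
          (1 / 2 : ℂ) * ∑ c ∈ C, (g (φ x) c c (φ y) + g c (φ y) (φ x) c))
        (fun x y z w => g (φ x) (φ y) (φ z) (φ w))
        (hnuc + (2 * ∑ c ∈ C, h c c + ∑ c ∈ C, ∑ d ∈ C, (2 * g c c d d - g c d d c))) N := by
  refine le_csInf (pqgEnergySet_nonempty _ _ _ (by omega)) ?_
  rintro E ⟨γ, Γ, hf, rfl⟩
  have hK := disjoint_orbs_rangeF_orbEmb φ hC
  have hf' := isDQGFeasible_frozen (orbEmb φ) γ Γ hK hf hN
  rw [card_orbs] at hf'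
  rw [← rdmEnergy_frozen φ h g hnuc γ Γ]
  exact pqgEnergy_le_rdmEnergy h g hnuc hf'

end Molecular

end Summit.Ventures.CertifiedQuantumChemistry

end
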